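import Mathlib.GroupTheory.SpecificGroups.Quaternion
import Mathlib.GroupTheory.OrderOfElement
import Mathlib.Tactic.Group
import HarnessLib

/-!
# The generalised quaternion RELATIONS identify the group with Mathlib's `QuaternionGroup n`

COR-CM (cell `pub-hodgecm2`), binder seat b04 (gen 34), count-neutral own lane «Galois-CM-type classification».  KERNEL ONLY,
Mathlib only: one theorem; no definition, no named fact, no `sorry`.  Companion of `CorCM/TwoGroupCyclicIndexTwoUniqueInvolution`
(gen 34: a `2`-group with at most one involution and an element `a` of index two is cyclic or satisfies the relations
`x a x⁻¹ = a⁻¹`, `x² = a^(|a|/2)` for some `x ∉ ⟨a⟩`) and feeder of `CorCM/TwoGroupUniqueInvolution` (the classical theorem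
«a finite `2`-group with a unique involution is cyclic or generalised quaternion», [Rotman1995, Thm. 5.46]).

* `nonempty_mulEquiv_quaternionGroup_of_relations` — `|G| = 4n`, `orderOf a = 2n`, `x ∉ ⟨a⟩`, `x a x⁻¹ = a⁻¹`, `x² = aⁿ` ⟹
  `G ≃* QuaternionGroup n`, via `a i ↦ a ^ i.val`, `xa i ↦ x * a ^ i.val` (a bijective homomorphism `QuaternionGroup n → G`:
  the four multiplication rules `a_mul_a`, `a_mul_xa`, `xa_mul_a`, `xa_mul_xa` of Mathlib's model are matched using
  `aᵏ x = x a⁻ᵏ`; injective since `x ∉ ⟨a⟩`; the orders agree).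

## References

* [Rotman1995] J. J. Rotman, *An Introduction to the Theory of Groups*, 4th ed., GTM 148, Springer 1995, Thm. 5.46 (generalised
  quaternion groups `Q_{2^n} = ⟨a, x | a^(2^(n-1)) = 1, x a x⁻¹ = a⁻¹, x² = a^(2^(n-2))⟩`).
-/

namespace Summit.HodgeConjecture.CorCM.GaloisModels.UniqueInvolution

variable {G : Type*} [Group G]

/-- **The relations identify the group.**  `|G| = 4n`, `orderOf a = 2n`, `x ∉ ⟨a⟩`, `x a x⁻¹ = a⁻¹`, `x² = aⁿ` ⟹
`G ≃* QuaternionGroup n` (Mathlib's generalised quaternion / dicyclic group of order `4n`: `a i ↦ aⁱ`, `xa i ↦ x aⁱ`).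
[cite: Rotman1995, Thm. 5.46] -/
theorem nonempty_mulEquiv_quaternionGroup_of_relations [Finite G] {n : ℕ} [NeZero n] {a x : G}
    (hcard : Nat.card G = 4 * n) (ha : orderOf a = 2 * n) (hx : x ∉ Subgroup.zpowers a)
    (hxa : x * a * x⁻¹ = a⁻¹) (hxx : x * x = a ^ n) : Nonempty (G ≃* QuaternionGroup n) := by
  classical
  haveI := Fintype.ofFinite G
  -- powers of `a` indexed by `ZMod (2n)`
  have hval : ∀ i j : ZMod (2 * n), a ^ (i + j).val = a ^ i.val * a ^ j.val := fun i j => by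
    rw [← pow_add, ZMod.val_add]
    conv_rhs => rw [← pow_mod_orderOf, ha]
  have hsub : ∀ i j : ZMod (2 * n), a ^ (j - i).val = a ^ j.val * (a ^ i.val)⁻¹ := fun i j => by
    rw [eq_mul_inv_iff_mul_eq, ← hval, sub_add_cancel]
  have hn : a ^ ((n : ZMod (2 * n)).val) = a ^ n := by
    rw [ZMod.val_natCast, ← ha, pow_mod_orderOf]
  have hcomm : ∀ i j : ℕ, (a ^ i)⁻¹ * a ^ j = a ^ j * (a ^ i)⁻¹ := fun i j =>
    ((Commute.pow_pow_self a i j).inv_left).eq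
  -- `aᵏ x = x a⁻ᵏ`
  have hxinv : ∀ k : ℕ, a ^ k * x = x * (a ^ k)⁻¹ := by
    intro k
    have h0 : x⁻¹ * a * x = a⁻¹ := by
      have h' : x⁻¹ * a⁻¹ * x = a := by
        conv_lhs => rw [← hxa]
        group
      rw [show x⁻¹ * a * x = (x⁻¹ * a⁻¹ * x)⁻¹ by group, h']
    have h1 : x⁻¹ * a ^ k * x = (a ^ k)⁻¹ := by
      have := map_pow (MulAut.conj x⁻¹) a k
      simp only [MulAut.conj_apply, inv_inv] at this
      rw [this, h0, inv_pow]
    calc a ^ k * x = x * (x⁻¹ * a ^ k * x) := by group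
      _ = x * (a ^ k)⁻¹ := by rw [h1]
  -- the map `QuaternionGroup n → G`
  let f : QuaternionGroup n → G := fun q => match q with
    | QuaternionGroup.a i => a ^ i.val
    | QuaternionGroup.xa i => x * a ^ i.val
  have hf_a : ∀ i, f (QuaternionGroup.a i) = a ^ i.val := fun i => rfl
  have hf_xa : ∀ i, f (QuaternionGroup.xa i) = x * a ^ i.val := fun i => rfl
  have hmul : ∀ p q, f (p * q) = f p * f q := by
    rintro (i | i) (j | j)
    · rw [QuaternionGroup.a_mul_a, hf_a, hf_a, hf_a, hval]
    · rw [QuaternionGroup.a_mul_xa, hf_xa, hf_a, hf_xa, hsub]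
      calc x * (a ^ j.val * (a ^ i.val)⁻¹) = x * ((a ^ i.val)⁻¹ * a ^ j.val) := by rw [hcomm]
        _ = a ^ i.val * x * a ^ j.val := by rw [hxinv, mul_assoc]
        _ = a ^ i.val * (x * a ^ j.val) := by rw [mul_assoc]
    · rw [QuaternionGroup.xa_mul_a, hf_xa, hf_xa, hf_a, hval, mul_assoc]
    · rw [QuaternionGroup.xa_mul_xa, hf_a, hf_xa, hf_xa, hsub, hval, hn]
      calc a ^ n * a ^ j.val * (a ^ i.val)⁻¹ = a ^ n * ((a ^ i.val)⁻¹ * a ^ j.val) := by rw [mul_assoc, hcomm]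
        _ = x * (a ^ i.val * x) * a ^ j.val := by
          rw [hxinv, ← hxx]
          group
        _ = x * a ^ i.val * (x * a ^ j.val) := by group
  have hinjval : ∀ i j : ZMod (2 * n), a ^ i.val = a ^ j.val → i = j := by
    intro i j h
    rw [pow_eq_pow_iff_modEq, ha] at h
    exact ZMod.val_injective _ (h.eq_of_lt_of_lt (ZMod.val_lt i) (ZMod.val_lt j))
  have hmemA : ∀ i j : ℕ, a ^ i * (a ^ j)⁻¹ ∈ Subgroup.zpowers a := fun i j =>
    Subgroup.mul_mem _ (Subgroup.npow_mem_zpowers a _) (Subgroup.inv_mem _ (Subgroup.npow_mem_zpowers a _))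
  have hinj : Function.Injective f := by
    rintro (i | i) (j | j) h
    · rw [hf_a, hf_a] at h
      rw [hinjval i j h]
    · exfalso
      rw [hf_a, hf_xa] at h
      refine hx ?_
      have : x = a ^ i.val * (a ^ j.val)⁻¹ := by rw [h, mul_inv_cancel_right]
      rw [this]
      exact hmemA _ _
    · exfalso
      rw [hf_a, hf_xa] at h
      refine hx ?_
      have : x = a ^ j.val * (a ^ i.val)⁻¹ := by rw [← h, mul_inv_cancel_right]
      rw [this]
      exact hmemA _ _
    · rw [hf_xa, hf_xa] at h
      rw [hinjval i j (mul_left_cancel h)]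
  have hbij : Function.Bijective f := by
    rw [Fintype.bijective_iff_injective_and_card]
    refine ⟨hinj, ?_⟩
    rw [QuaternionGroup.card, ← Nat.card_eq_fintype_card, hcard]
  exact ⟨(MulEquiv.ofBijective (MonoidHom.mk' f hmul) hbij).symm⟩

end Summit.HodgeConjecture.CorCM.GaloisModels.UniqueInvolution
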